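import Summits.QuantumAdvantage.QuantumAdvantage.Theorems.CodimDialMedium

/-!
# CodimDial — part 6/6 «Few» (cell decomp-qadv, seat lens-5, generation 12 rev 2; supports item 30910 `SpreadDial.PureCover3`)

§11 THE PIECES IN THE ROUTE'S CURRENCY: `SpreadLossFew3` (29064 verbatim with `m ≤ (log₂ n)^a`, every `a`), `LinSpreadPool3` (pool `≤ n·(log₂ n)^a`), **`FewCover3`**, **`FewBridge3`**; BLOCK COMPRESSION `compress` (`blockRow`, `blockFn`, `bit_blockFn`, `sum_defect_blockRow`); `leak_step`; ★ `linSpreadLogMed3_iff_spreadLossFew3`, `linSpreadPool3_iff_spreadLossFew3`, `spreadLossFew3_of_spreadLoss3`; ★ THE `m`-AXIS SPLIT `pureCover3_iff_fewPieces : SpreadDial.PureCover3 ↔ (FewCover3 ∧ FewBridge3)`, `closes₅` (leaf BY NAME), necessity.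

Verbatim from the node file `run/shared/lean/pub/decomp-qadv/decomp-qadv-lens-5/g12/CodimDial.lean` (rev 2, sha256 b503e7e59b532c38…;
record `…/g12/NODE-g12.md`; critic row 74 VERIFIED/CLEARED the split), re-namespaced `…Theses.CodimDial` ↦ `…Theorems.CodimDial`;
imports part 5/6 (`CodimDialMedium`); joint check of parts 1–6 = `g12/tree/Parts1to6.check.lean` (farm rc 0 · 0 errors ·
0 warnings · 0 sorries).  The `def … : Prop` declarations are STATEMENTS OF THE NODE (regimes of the dial and the two pieces of the exact split
`PureCover3 ⟺ A ∧ B`), not new cruxes; the pieces to FILE are `FewCover3` / `FewBridge3` (part 6) or equivalently `LinCoverLogMed3` / `MedBridge3` (part 5).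
NODE EQUATION: `AdviceFreeQNC0Three ⟸ PolyLoss3 [26123] ∧ AlgCover3 [30909] ∧ A ∧ B`, `PureCover3 (30910) ⟺ A ∧ B` (kernel).
-/

set_option linter.style.longLine false
set_option linter.dupNamespace false

noncomputable section
open scoped Classical

namespace Summit.QuantumAdvantage.QuantumAdvantage.Theorems.CodimDial

open Finset
open Literature.Computability.QuantumComplexity Literature.Computability.QuantumComplexity.RingHLF
open Literature.Computability.MetaComplexity
open Summit.QuantumAdvantage.AdviceFreeQNC0
open Summit.QuantumAdvantage.QuantumAdvantage.Theses

/-! ## §11  FEW RINGS ⟺ MEDIUM SYSTEMS ⟺ SMALL POOLS: the pieces in the route's own currency (the `m`-axis of 29064)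

Three descriptions of ONE regime, proved equivalent as spread statements:
(few)    `SpreadLossFew3`  — 29064 for `m ≤ (log₂ n)^a` foreign rings (every `a`);
(medium) `LinSpreadLogMed3` — `2^ℓ ≤ n^C` rows of weight `≤ n/4` on a pool of `N ≤ n^C` polylog-degree bits;
(pool)   `LinSpreadPool3`  — ARBITRARY systems on a SMALL pool `N ≤ n·(log₂ n)^a`.
few ⟹ medium is the host construction (§10, `m = ℓ ≤ (log₂ n)²` rings); medium ⟹ pool is the collapse (§3) followed by
BLOCK COMPRESSION (a heavy row on a small pool = a medium row on the pool of its polylog-block parities, which are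
polylog-degree `𝔽₃`-functions); pool ⟹ few is the embedding (§5, pool `m·n`).  Hence the conjunct split of 30910 reads,
in the route's currency, as the `m`-AXIS SPLIT: `PureCover3 ⟺ FewCover3 ∧ FewBridge3` (`pureCover3_iff_fewPieces`). -/

section Few
variable {n : ℕ}

/-- **SpreadLossFew3** — 29064 for POLYLOGARITHMICALLY MANY foreign rings (`m ≤ (log₂ n)^a`, every `a`). -/
def SpreadLossFew3 : Prop :=
  ∃ η : ℝ, 0 < η ∧ ∃ k : ℕ, ∀ a c : ℕ, ∃ n₀ : ℕ, ∀ n ≥ n₀, ∀ P : Fin n → Smolensky.CubeFn (ZMod 3) n,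
    (∀ i, P i ∈ Smolensky.lowDeg (ZMod 3) n ((Nat.log 2 n) ^ c)) →
    ∀ m : ℕ, m ≤ (Nat.log 2 n) ^ a → ∀ w : Fin m → Fin n → Bool, ∀ Q : Fin m → Fin n → Smolensky.CubeFn (ZMod 3) n,
      (∀ t i, Q t i ∈ Smolensky.lowDeg (ZMod 3) n ((Nat.log 2 n) ^ c)) →
      (1 - η) * (2 : ℝ) ^ n ≤
        ((univ.filter fun y : Fin n → Bool => ∀ t, RingHLF.Rel (w t) (fun i => decide (Q t i y = 1))).card : ℝ) →
      1 / (n : ℝ) ^ k * (2 : ℝ) ^ n ≤ ((univ.filter fun y : Fin n → Bool =>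
        (∀ t, RingHLF.Rel (w t) (fun i => decide (Q t i y = 1))) ∧ ¬ RingHLF.Rel y (fun i => decide (P i y = 1))).card : ℝ)

/-- **LinSpreadPool3** — SMALL POOLS: the dial with pool size `N ≤ n·(log₂ n)^a`, ARBITRARY codimension and weight. -/
def LinSpreadPool3 : Prop :=
  ∃ η : ℝ, 0 < η ∧ ∃ k : ℕ, ∀ a c : ℕ, ∃ n₀ : ℕ, ∀ n ≥ n₀, ∀ P : Fin n → Smolensky.CubeFn (ZMod 3) n,
    (∀ i, P i ∈ Smolensky.lowDeg (ZMod 3) n ((Nat.log 2 n) ^ c)) →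
    ∀ N : ℕ, N ≤ n * (Nat.log 2 n) ^ a → ∀ G : Fin N → Smolensky.CubeFn (ZMod 3) n,
      (∀ u, G u ∈ Smolensky.lowDeg (ZMod 3) n ((Nat.log 2 n) ^ c)) →
      ∀ ℓ : ℕ, ∀ A : Fin ℓ → Fin N → ZMod 2, ∀ b : Fin ℓ → ZMod 2,
        (1 - η) * (2 : ℝ) ^ n ≤ ((linEvent G A b).card : ℝ) →
          1 / (n : ℝ) ^ k * (2 : ℝ) ^ n ≤ ((linEvent G A b ∩ lossSet P).card : ℝ)

/-- **piece A in the route's currency** [⟺ `LinCoverLogMed3` PROVED (`fewCover3_iff_linCoverLogMed3`); tags as A]: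
`PolyLoss3 → AlgSpread3 → SpreadLossFew3` — 30910 for polylogarithmically many foreign rings. -/
def FewCover3 : Prop := SpreadDial.PolyLoss3 → SpreadDial.AlgSpread3 → SpreadLossFew3

/-- **piece B in the route's currency** [⟺ `MedBridge3` PROVED (`fewBridge3_iff_medBridge3`); tags as B]: the
COUNTING BRIDGE of 29064 — spread against polylog many foreign rings ⟹ spread against polynomially many. -/
def FewBridge3 : Prop := SpreadLossFew3 → SpreadDial.SpreadLoss3

/-! ### Block compression -/

/-- block `j` (size `B`) of a row: the row restricted to the pool indices `u` with `u / B = j`. -/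
def blockRow {N : ℕ} (a : Fin N → ZMod 2) (B j : ℕ) : Fin N → ZMod 2 := fun u => if u.val / B = j then a u else 0

/-- CodimDialFewA helper `rowWeight_blockRow_le` (decomp-qadv land package; see the module docstring). -/
theorem rowWeight_blockRow_le {N : ℕ} (a : Fin N → ZMod 2) {B : ℕ} (hB : 0 < B) (j : ℕ) :
    rowWeight (blockRow a B j) ≤ B := by
  unfold rowWeight blockRow
  calc (univ.filter fun u : Fin N => (if u.val / B = j then a u else 0) ≠ 0).card
      ≤ (univ.filter fun u : Fin N => u.val / B = j).card := card_le_card fun u hu => by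
          simp only [mem_filter, mem_univ, true_and] at hu ⊢
          by_contra h
          exact hu (by rw [if_neg h])
    _ ≤ (Finset.range B).card := by
        refine Finset.card_le_card_of_injOn (fun u => u.val % B) (fun u _ => ?_) ?_
        · exact Finset.mem_coe.mpr (Finset.mem_range.mpr (Nat.mod_lt _ hB))
        · intro u hu u' hu' h
          simp only [coe_filter, mem_univ, true_and, Set.mem_setOf_eq] at hu hu'
          apply Fin.ext
          have e1 := Nat.div_add_mod u.val B
          have e2 := Nat.div_add_mod u'.val B
          simp only at h
          rw [← e1, ← e2, hu, hu', h]
    _ = B := Finset.card_range B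

/-- the BLOCK FUNCTION: the `𝔽₃`-polynomial `1 − rowInd` of a block, whose bit is the block's partial defect. -/
def blockFn {N : ℕ} (G : Fin N → Smolensky.CubeFn (ZMod 3) n) (a : Fin N → ZMod 2) (B j : ℕ) :
    Smolensky.CubeFn (ZMod 3) n :=
  1 - rowInd G (blockRow a B j) 0

/-- CodimDialFewA helper `bit_blockFn` (decomp-qadv land package; see the module docstring). -/
theorem bit_blockFn {N : ℕ} (G : Fin N → Smolensky.CubeFn (ZMod 3) n) (a : Fin N → ZMod 2) (B j : ℕ)
    (y : Fin n → Bool) : bit (blockFn G a B j) y = defect G (blockRow a B j) 0 y := by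
  unfold blockFn bit
  rw [Pi.sub_apply, Pi.one_apply, rowInd_apply]
  rcases (by decide : ∀ t : ZMod 2, t = 0 ∨ t = 1) (defect G (blockRow a B j) 0 y) with h | h
  · rw [h, if_pos rfl]; simp
  · rw [h, if_neg one_ne_zero]; simp

/-- CodimDialFewA helper `blockFn_mem_lowDeg` (decomp-qadv land package; see the module docstring). -/
theorem blockFn_mem_lowDeg {N D B : ℕ} (hB : 0 < B) (G : Fin N → Smolensky.CubeFn (ZMod 3) n)
    (hG : ∀ u, G u ∈ Smolensky.lowDeg (ZMod 3) n D) (a : Fin N → ZMod 2) (j : ℕ) :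
    blockFn G a B j ∈ Smolensky.lowDeg (ZMod 3) n (B * (D + D)) :=
  Submodule.sub_mem _ (Smolensky.one_mem_lowDeg _) (rowInd_mem_lowDeg G hG _ _ (rowWeight_blockRow_le a hB j))

/-- summing the block defects gives back the row defect. -/
theorem sum_defect_blockRow {N : ℕ} (G : Fin N → Smolensky.CubeFn (ZMod 3) n) (a : Fin N → ZMod 2) (B : ℕ)
    (β : ZMod 2) (y : Fin n → Bool) :
    (∑ j : Fin (N / B + 1), defect G (blockRow a B j.val) 0 y) + β = defect G a β y := by
  unfold defect blockRow
  simp only [add_zero]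
  congr 1
  rw [Finset.sum_comm]
  refine Finset.sum_congr rfl fun u _ => ?_
  rw [← Finset.sum_mul]
  congr 1
  have hu : u.val / B < N / B + 1 := Nat.lt_succ_of_le (Nat.div_le_div_right u.isLt.le)
  rw [Finset.sum_eq_single ⟨u.val / B, hu⟩]
  · simp
  · intro j _ hj
    rw [if_neg]
    intro h
    exact hj (Fin.ext h.symm)
  · intro h; exact absurd (mem_univ _) h

/-- **BLOCK COMPRESSION**: any system of `ℓ` rows on a pool of `N` bits of degree `≤ D` has the SAME event as a
system of `ℓ` rows of weight `≤ N/B + 1` on the pool of the `ℓ·(N/B + 1)` block functions (degree `≤ B·2D`). -/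
theorem compress {N ℓ D B : ℕ} (hB : 0 < B) (G : Fin N → Smolensky.CubeFn (ZMod 3) n)
    (hG : ∀ u, G u ∈ Smolensky.lowDeg (ZMod 3) n D) (A : Fin ℓ → Fin N → ZMod 2) (b : Fin ℓ → ZMod 2) :
    ∃ (G' : Fin (ℓ * (N / B + 1)) → Smolensky.CubeFn (ZMod 3) n) (A' : Fin ℓ → Fin (ℓ * (N / B + 1)) → ZMod 2),
      (∀ u', G' u' ∈ Smolensky.lowDeg (ZMod 3) n (B * (D + D))) ∧ (∀ r, rowWeight (A' r) ≤ N / B + 1) ∧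
      linEvent G' A' b = linEvent G A b := by
  let e : Fin ℓ × Fin (N / B + 1) ≃ Fin (ℓ * (N / B + 1)) := finProdFinEquiv
  let G' : Fin (ℓ * (N / B + 1)) → Smolensky.CubeFn (ZMod 3) n :=
    fun u' => blockFn G (A (e.symm u').1) B (e.symm u').2.val
  let A' : Fin ℓ → Fin (ℓ * (N / B + 1)) → ZMod 2 := fun r u' => if (e.symm u').1 = r then 1 else 0
  refine ⟨G', A', fun u' => blockFn_mem_lowDeg hB G hG _ _, fun r => ?_, ?_⟩
  · unfold rowWeight
    calc (univ.filter fun u' => A' r u' ≠ 0).card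
        ≤ ((univ : Finset (Fin (N / B + 1))).image fun j => e (r, j)).card := card_le_card fun u' hu' => by
            simp only [mem_filter, mem_univ, true_and, A'] at hu'
            have hr : (e.symm u').1 = r := by
              by_contra h
              exact hu' (by rw [if_neg h])
            rw [Finset.mem_image]
            refine ⟨(e.symm u').2, mem_univ _, ?_⟩
            rw [← hr, Prod.mk.eta, Equiv.apply_symm_apply]
      _ ≤ (univ : Finset (Fin (N / B + 1))).card := Finset.card_image_le
      _ = N / B + 1 := by simp
  · have hdef : ∀ r y, defect G' (A' r) (b r) y = defect G (A r) (b r) y := by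
      intro r y
      rw [← sum_defect_blockRow G (A r) B (b r) y]
      simp only [← bit_blockFn]
      show (∑ u', A' r u' * bit (G' u') y) + b r = _
      congr 1
      rw [← e.sum_comp (fun u' => A' r u' * bit (G' u') y)]
      simp only [A', G', Equiv.symm_apply_apply]
      rw [Fintype.sum_prod_type, Finset.sum_eq_single r]
      · simp
      · intro r' _ hr'
        exact Finset.sum_eq_zero fun j _ => by rw [if_neg hr', zero_mul]
      · intro h; exact absurd (mem_univ r) h
    ext y
    simp only [linEvent, mem_filter, mem_univ, true_and, hdef]

/-! ### The leak arithmetic of the collapse, isolated -/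

/-- if the combined event `E'` contains `E`, loses `≥ 2ⁿ/n^k`, and `E' \ E ⊆ Bad` with `#Bad·2^ℓ ≤ 2ⁿ`,
`2n^k ≤ 2^ℓ`, then `E` loses `≥ 2ⁿ/n^(k+1)`. [arithmetic, as in §4] -/
theorem leak_step {k ℓ : ℕ} (hn2 : 2 ≤ n) (h2ℓ : 2 * n ^ k ≤ 2 ^ ℓ) {E E' Ls Bad : Finset (Fin n → Bool)}
    (hcover : E' ∩ Ls ⊆ (E ∩ Ls) ∪ Bad) (hBad : Bad.card * 2 ^ ℓ ≤ 2 ^ n)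
    (hmain : 1 / (n : ℝ) ^ k * (2 : ℝ) ^ n ≤ ((E' ∩ Ls).card : ℝ)) :
    1 / (n : ℝ) ^ (k + 1) * (2 : ℝ) ^ n ≤ ((E ∩ Ls).card : ℝ) := by
  have hcard : (E' ∩ Ls).card ≤ (E ∩ Ls).card + Bad.card :=
    le_trans (card_le_card hcover) (Finset.card_union_le _ _)
  set a : ℝ := ((E ∩ Ls).card : ℝ) with ha
  have ha0 : 0 ≤ a := by positivity
  have hnk : (0 : ℝ) < (n : ℝ) ^ k := by positivity
  have hX : (0 : ℝ) < (2 : ℝ) ^ n := by positivity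
  have hcardR : ((E' ∩ Ls).card : ℝ) ≤ a + (Bad.card : ℝ) := by rw [ha]; exact_mod_cast hcard
  have hBadR : (Bad.card : ℝ) * (2 : ℝ) ^ ℓ ≤ (2 : ℝ) ^ n := by exact_mod_cast hBad
  have h2ℓR : 2 * (n : ℝ) ^ k ≤ (2 : ℝ) ^ ℓ := by exact_mod_cast h2ℓ
  have hB2 : 2 * ((Bad.card : ℝ) * (n : ℝ) ^ k) ≤ (2 : ℝ) ^ n := by
    calc 2 * ((Bad.card : ℝ) * (n : ℝ) ^ k) = (Bad.card : ℝ) * (2 * (n : ℝ) ^ k) := by ring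
      _ ≤ (Bad.card : ℝ) * (2 : ℝ) ^ ℓ := mul_le_mul_of_nonneg_left h2ℓR (by positivity)
      _ ≤ (2 : ℝ) ^ n := hBadR
  have hmain' : (2 : ℝ) ^ n ≤ a * (n : ℝ) ^ k + (Bad.card : ℝ) * (n : ℝ) ^ k := by
    have e1 : 1 / (n : ℝ) ^ k * (2 : ℝ) ^ n = (2 : ℝ) ^ n / (n : ℝ) ^ k := by ring
    rw [e1, div_le_iff₀ hnk] at hmain
    nlinarith [hmain, hcardR, hnk.le]
  have hfinal : (2 : ℝ) ^ n ≤ a * (n : ℝ) ^ (k + 1) := by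
    have hn2R : (2 : ℝ) ≤ n := by exact_mod_cast hn2
    calc (2 : ℝ) ^ n ≤ 2 * (a * (n : ℝ) ^ k) := by linarith
      _ ≤ (n : ℝ) * (a * (n : ℝ) ^ k) := mul_le_mul_of_nonneg_right hn2R (by positivity)
      _ = a * (n : ℝ) ^ (k + 1) := by ring
  calc 1 / (n : ℝ) ^ (k + 1) * (2 : ℝ) ^ n = (2 : ℝ) ^ n / (n : ℝ) ^ (k + 1) := by ring
    _ ≤ a := by rw [div_le_iff₀ (by positivity)]; exact hfinal


end Few
end Summit.QuantumAdvantage.QuantumAdvantage.Theorems.CodimDial
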